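import Literature.AnabelianGeometry.SemiGraphs.CoveringPullbackCompLaw
import Literature.AnabelianGeometry.SemiGraphs.CoveringGraphIsoOver
import HarnessLib

/-!
# [SemiAnbd] Proposition 3.6 (iv): the pull-back functor depends only on the CONJUGACY CLASS of the
# decorated morphism `(F, θ)` (route T · TRANSPORT X)

Mochizuki, *Semi-graphs of anabelioids*, Publ. RIMS **42** (2006), §3, Proposition 3.6 (iv), manuscript
p. 39 [cite: MochizukiSemiAnbd2006, Prop 3.6(iv) p.39]; Remark 2.4.2 p. 26 (a morphism of semi-graphs of
anabelioids = 1-morphisms `φ_v`, `φ_e` of the constituent anabelioids AND 2-cells `φ_b` at the branches);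
§3 p. 37 / Definition 5.1 (iv) p. 63 (morphisms are read "up to composition with the inner action").

A morphism `F : Hom 𝒢′ 𝒢` (local presentation) carries `F_{v′}`, `F_{e′}` and a family of 2-cells
`θ : F.ConjugatorFamily` (abc-iut-L3-d4); the pull-back functor `F^*_θ = F.covPullbackWith θ` glues along `θ`.
Pull-backs along DIFFERENT families of 2-cells are in general not isomorphic (cell finding d4-F3 / RQ12; kernel
witness `ProfiniteSemiGraph.not_inducesOfCompatible`, `TemperedReconstructionR3Refutation.lean`).  This file is
the positive complement — WHICH changes of `(F, θ)` leave `F^*_θ` unchanged: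

* ★ `Hom.covPullbackWithConjIso` (+ `btemp…`, `chart…` forms): decorated morphisms `(F, θ)`, `(F′, θ′)` over
  ONE morphism of semi-graphs that are CONJUGATE — `F′_{v′} = g_{v′} F_{v′}(−) g_{v′}⁻¹`,
  `F′_{e′} = g_{e′} F_{e′}(−) g_{e′}⁻¹`, `θ′_{b′} = g_{v′} · θ_{b′} · (F b′)_*(g_{e′})⁻¹` — have isomorphic
  pull-back functors `F^*_θ ≅ F′^*_{θ′}` (acting by `g_{v′}` / `g_{e′}` on the fibres); stated for
  `F′ = ⟨F.base, F′_{v′}, F′_{e′}, _⟩`, and as `Hom.nonempty_covPullbackWith_iso_of_conj` (etc.) for any `F′`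
  with `F′.base = F.base` through the transports `castGv` / `castGe`; `Hom.ConjugatorFamily.conjBy` = the
  forced family `θ′` IS a family of 2-cells of `F′`;
* `Hom.covPullbackWithTwistIso`: two families `θ`, `θ′` of ONE morphism with `θ′_{b′} = z_{v′} θ_{b′} (F b′)_*(k_{e′})⁻¹`,
  `z_{v′}` / `k_{e′}` centralising the images of `F_{v′}` / `F_{e′}`, give isomorphic pull-backs — twists
  UNIFORM along an edge are invisible (the RQ12 witness twists ONE branch of a loop);
* `Hom.nonempty_chartPullbackWith_mul_iso_of_conj` / `…_one_iso_of_conj`: the pseudo-functoriality binders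
  `hmul` / `hone` of `ArithOuterActionOfGraphAction.lean` for graph actions given UP TO CONJUGATION
  (`(A (a b), θ (a b))` conjugate to `(A b ≫ A a, θ b ∘ θ a)`, `(A 1, θ 1)` to `(id, 1)`), by abc-iut-L3-d6's
  laws `chartPullbackWithCompIso` / `chartPullbackWithIdentityIso` (`CoveringPullbackCompLaw.lean`).

So `F ↦ F^*` is well defined on decorated morphisms up to conjugation, as print reads morphisms.  Definitions =
natural-iso DATA + the forced family; no instance / notation / named fact; nothing here bears on [IUTchIII] Cor. 3.12.
-/

noncomputable section

open CategoryTheory Topology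

namespace Literature.AnabelianGeometry.SemiGraphs

open Literature.AlgebraicGeometry.Frobenioids.QuasiTemperoid.BTempConnected (hom_ext_apply hom_ρ
  ρ_mul_apply)

universe u

namespace ProfiniteSemiGraph

variable {𝒢' 𝒢 : ProfiniteSemiGraph.{u}}

namespace Hom

/-! ### Conjugate decorated morphisms over one morphism of semi-graphs -/

section Core

variable (F : Hom 𝒢' 𝒢) (θ : F.ConjugatorFamily)
  (hV' : ∀ v' : 𝒢'.graph.Vertex, 𝒢'.Gv v' →ₜ* 𝒢.Gv (F.base.vertexMap v'))
  (hE' : ∀ e' : 𝒢'.graph.Edge, 𝒢'.Ge e' →ₜ* 𝒢.Ge (F.base.edgeMap e'))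
  (comm' : ∀ (b' : 𝒢'.graph.Branch) (v' : 𝒢'.graph.Vertex) (h' : 𝒢'.graph.abuts b' = some v'),
    ∃ g : 𝒢.Gv (F.base.vertexMap v'), ∀ x : 𝒢'.Ge (𝒢'.graph.edgeOf b'),
      hV' v' (𝒢'.brHom b' v' h' x) =
        g * 𝒢.brHom (F.base.branchMap b') (F.base.vertexMap v') (F.base.abuts_branchMap b' v' h')
          (F.base.edgeOf_branchMap b' ▸ hE' (𝒢'.graph.edgeOf b') x) * g⁻¹)
  (gV : ∀ v' : 𝒢'.graph.Vertex, 𝒢.Gv (F.base.vertexMap v'))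
  (gE : ∀ e' : 𝒢'.graph.Edge, 𝒢.Ge (F.base.edgeMap e'))
  (hgV : ∀ (v' : 𝒢'.graph.Vertex) (x : 𝒢'.Gv v'), hV' v' x = gV v' * F.hV v' x * (gV v')⁻¹)
  (hgE : ∀ (e' : 𝒢'.graph.Edge) (x : 𝒢'.Ge e'), hE' e' x = gE e' * F.hE e' x * (gE e')⁻¹)

/-- The image `(F b′)_*(g_{e′}) ∈ Π_{F v′}` of an element of `Π_{F e′}` under the branch map of `F b′`: `brHomAt`
= `b_*` after the transport along `edgeOf (F b′) = F (edgeOf b′)`. [cite: MochizukiSemiAnbd2006, Def. 2.1 p.23] -/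
theorem brHomAt_eq_brHom_castGe (b' : 𝒢'.graph.Branch) (v' : 𝒢'.graph.Vertex)
    (h' : 𝒢'.graph.abuts b' = some v') (k : 𝒢.Ge (F.base.edgeMap (𝒢'.graph.edgeOf b'))) :
    𝒢.brHomAt (F.base.branchMap b') (F.base.vertexMap v') (F.base.abuts_branchMap b' v' h')
        (F.base.edgeMap (𝒢'.graph.edgeOf b')) (F.base.edgeOf_branchMap b') k =
      𝒢.brHom (F.base.branchMap b') (F.base.vertexMap v') (F.base.abuts_branchMap b' v' h')
        (𝒢.castGe (F.base.edgeOf_branchMap b').symm k) := by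
  rw [brHomAt_apply, eqRec_eq_castGe (F.base.edgeOf_branchMap b')]

/-- **The family of 2-cells forced on a conjugate.**  If `F′_{v′} = g_{v′} F_{v′}(−) g_{v′}⁻¹` and
`F′_{e′} = g_{e′} F_{e′}(−) g_{e′}⁻¹`, then `θ′_{b′} := g_{v′} · θ_{b′} · (F b′)_*(g_{e′})⁻¹` is a family of
2-cells for `F′ = ⟨F.base, F′_{v′}, F′_{e′}, _⟩`. [cite: MochizukiSemiAnbd2006, Rmk 2.4.2 p.26] -/
def ConjugatorFamily.conjBy : (⟨F.base, hV', hE', comm'⟩ : Hom 𝒢' 𝒢).ConjugatorFamily where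
  θ b' v' h' := gV v' * θ.θ b' v' h' *
    (𝒢.brHomAt (F.base.branchMap b') (F.base.vertexMap v') (F.base.abuts_branchMap b' v' h')
      (F.base.edgeMap (𝒢'.graph.edgeOf b')) (F.base.edgeOf_branchMap b') (gE (𝒢'.graph.edgeOf b')))⁻¹
  spec b' v' h' x := by
    -- `brComp` of `F′` is `(F b′)_* ∘ F′_{e′}` with `F′_{e′} = g F_{e′} g⁻¹`
    have hs := θ.spec b' v' h' x
    change gV v' * θ.θ b' v' h' * (𝒢.brHomAt _ _ _ _ _ (gE _))⁻¹ * 𝒢.brHomAt _ _ _ _ _ (hE' _ x) *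
        (gV v' * θ.θ b' v' h' * (𝒢.brHomAt _ _ _ _ _ (gE _))⁻¹)⁻¹ = hV' v' (𝒢'.brHom b' v' h' x)
    change θ.θ b' v' h' * 𝒢.brHomAt _ _ _ _ _ (F.hE _ x) * (θ.θ b' v' h')⁻¹ =
      F.hV v' (𝒢'.brHom b' v' h' x) at hs
    rw [hgV, ← hs, hgE, map_mul, map_mul, map_inv]
    group

variable (θ' : (⟨F.base, hV', hE', comm'⟩ : Hom 𝒢' 𝒢).ConjugatorFamily)
  (hθ : ∀ (b' : 𝒢'.graph.Branch) (v' : 𝒢'.graph.Vertex) (h' : 𝒢'.graph.abuts b' = some v'),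
    θ'.θ b' v' h' = gV v' * θ.θ b' v' h' *
      (𝒢.brHomAt (F.base.branchMap b') (F.base.vertexMap v') (F.base.abuts_branchMap b' v' h')
        (F.base.edgeMap (𝒢'.graph.edgeOf b')) (F.base.edgeOf_branchMap b')
        (gE (𝒢'.graph.edgeOf b')))⁻¹)

include hθ in
/-- **The gluings of the two pull-backs differ by the conjugating elements**: along `b′ ↦ v′`, gluing
`F′^*_{θ′} S` after acting by `g_{e′}` on the edge fibre = acting by `g_{v′}` after gluing `F^*_θ S`, because
`θ′_{b′} · (F b′)_*(g_{e′}) = g_{v′} · θ_{b′}`. [cite: MochizukiSemiAnbd2006, Prop 3.6(iv) p.39] -/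
theorem covPullbackWith_glue_conj_apply (S : CovObj 𝒢) (b' : 𝒢'.graph.Branch) (v' : 𝒢'.graph.Vertex)
    (h' : 𝒢'.graph.abuts b' = some v')
    (x : (((F.covPullbackWith θ).obj S).SE (𝒢'.graph.edgeOf b')).obj.V) :
    (((Hom.covPullbackWith ⟨F.base, hV', hE', comm'⟩ θ').obj S).glue b' v' h').hom.hom.hom
        ((S.SE (F.base.edgeMap (𝒢'.graph.edgeOf b'))).obj.ρ (gE (𝒢'.graph.edgeOf b')) x) =
      (S.SV (F.base.vertexMap v')).obj.ρ (gV v')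
        ((((F.covPullbackWith θ).obj S).glue b' v' h').hom.hom.hom x) := by
  rw [covPullbackWith_glue_apply_castPtE, covPullbackWith_glue_apply_castPtE, CovObj.castPtE_ρ, hθ,
    hom_ρ (S.glue (F.base.branchMap b') (F.base.vertexMap v') (F.base.abuts_branchMap b' v' h')).hom,
    BTemp.res_obj_ρ_apply, ← ρ_mul_apply, ← ρ_mul_apply, ← F.brHomAt_eq_brHom_castGe b' v' h']
  congr 1
  group

/-- The comparison isomorphism `F^*_θ S ≅ F′^*_{θ′} S` of one object: act by `g_{v′}` on the vertex fibre over
`v′` and by `g_{e′}` on the edge fibre over `e′` (`BTemp.resIsoOfConj`). [cite: MochizukiSemiAnbd2006, Prop 3.6(iv) p.39] -/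
def covPullbackWithConjIsoApp (S : CovObj 𝒢) :
    (F.covPullbackWith θ).obj S ≅ (Hom.covPullbackWith ⟨F.base, hV', hE', comm'⟩ θ').obj S :=
  CovObj.isoOfComponents
    (fun v' => (BTemp.resIsoOfConj (F.hV v') (hV' v') (gV v') fun a => (hgV v' a).symm).app
      (S.SV (F.base.vertexMap v')))
    (fun e' => (BTemp.resIsoOfConj (F.hE e') (hE' e') (gE e') fun a => (hgE e' a).symm).app
      (S.SE (F.base.edgeMap e')))
    (fun b' v' h' => hom_ext_apply fun x =>
      covPullbackWith_glue_conj_apply F θ hV' hE' comm' gV gE θ' hθ S b' v' h' x)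

/-- The comparison acts by `g_{v′}` on the vertex fibre over `v′`. [cite: MochizukiSemiAnbd2006, Prop 3.6(iv) p.39] -/
@[simp] theorem covPullbackWithConjIsoApp_hom_fV_apply (S : CovObj 𝒢) (v' : 𝒢'.graph.Vertex)
    (x : (((F.covPullbackWith θ).obj S).SV v').obj.V) :
    ((covPullbackWithConjIsoApp F θ hV' hE' comm' gV gE hgV hgE θ' hθ S).hom.fV v').hom.hom x =
      (S.SV (F.base.vertexMap v')).obj.ρ (gV v') x :=
  rfl

/-- The comparison acts by `g_{e′}` on the edge fibre over `e′`. [cite: MochizukiSemiAnbd2006, Prop 3.6(iv) p.39] -/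
@[simp] theorem covPullbackWithConjIsoApp_hom_fE_apply (S : CovObj 𝒢) (e' : 𝒢'.graph.Edge)
    (x : (((F.covPullbackWith θ).obj S).SE e').obj.V) :
    ((covPullbackWithConjIsoApp F θ hV' hE' comm' gV gE hgV hgE θ' hθ S).hom.fE e').hom.hom x =
      (S.SE (F.base.edgeMap e')).obj.ρ (gE e') x :=
  rfl

/-- ★ **Conjugate decorated morphisms have isomorphic pull-back functors** `B^cov(𝒢) ⥤ B^cov(𝒢′)`:
`F^*_θ ≅ F′^*_{θ′}` for `F′ = ⟨F.base, g_{v′} F_{v′} g_{v′}⁻¹, g_{e′} F_{e′} g_{e′}⁻¹, _⟩` and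
`θ′_{b′} = g_{v′} θ_{b′} (F b′)_*(g_{e′})⁻¹` (natural: morphisms of `B^cov` are equivariant on every fibre).
[cite: MochizukiSemiAnbd2006, Prop 3.6(iv) p.39] -/
def covPullbackWithConjIso :
    F.covPullbackWith θ ≅ Hom.covPullbackWith ⟨F.base, hV', hE', comm'⟩ θ' :=
  NatIso.ofComponents (fun S => covPullbackWithConjIsoApp F θ hV' hE' comm' gV gE hgV hgE θ' hθ S)
    fun {S T} f => by
      refine CovHom.ext (funext fun v' => ?_) (funext fun e' => ?_)
      · exact hom_ext_apply fun x => (hom_ρ (f.fV (F.base.vertexMap v')) (gV v') x).symm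
      · exact hom_ext_apply fun x => (hom_ρ (f.fE (F.base.edgeMap e')) (gE e') x).symm

/-- ★ **The `B^temp` form**: `F^*_θ ≅ F′^*_{θ′}` as functors `B^temp(𝒢) ⥤ B^temp(𝒢′)`. [cite: MochizukiSemiAnbd2006, Prop 3.6(iv) p.39] -/
def btempPullbackWithConjIso :
    F.btempPullbackWith θ ≅ Hom.btempPullbackWith ⟨F.base, hV', hE', comm'⟩ θ' :=
  ((ObjectProperty.fullyFaithfulι _).whiskeringRight _).preimageIso
    (Functor.isoWhiskerLeft (ObjectProperty.ι _)
      (covPullbackWithConjIso F θ hV' hE' comm' gV gE hgV hgE θ' hθ))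

/-- ★ **The chart form**: for charts `c′`, `c` of the tempered fundamental groups, `F^*_θ ≅ F′^*_{θ′}` as
functors `B^temp(π₁^temp 𝒢) ⥤ B^temp(π₁^temp 𝒢′)`. [cite: MochizukiSemiAnbd2006, Prop 3.6(iv) p.39] -/
def chartPullbackWithConjIso (c' : TemperedPiChart 𝒢') (c : TemperedPiChart 𝒢) :
    F.chartPullbackWith θ c' c ≅ Hom.chartPullbackWith ⟨F.base, hV', hE', comm'⟩ θ' c' c :=
  Functor.isoWhiskerLeft c.equiv.inverse
    (Functor.isoWhiskerRight (btempPullbackWithConjIso F θ hV' hE' comm' gV gE hgV hgE θ' hθ)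
      c'.equiv.functor)

end Core

/-! ### Arbitrary `F′` over the same morphism of semi-graphs -/

section SameBase

variable {F F' : Hom 𝒢' 𝒢} (hbase : F'.base = F.base) (θ : F.ConjugatorFamily)
  (θ' : F'.ConjugatorFamily)
  (gV : ∀ v' : 𝒢'.graph.Vertex, 𝒢.Gv (F.base.vertexMap v'))
  (gE : ∀ e' : 𝒢'.graph.Edge, 𝒢.Ge (F.base.edgeMap e'))
  (hgV : ∀ (v' : 𝒢'.graph.Vertex) (x : 𝒢'.Gv v'),
    𝒢.castGv (congrArg (fun k : 𝒢'.graph ⟶ 𝒢.graph => k.vertexMap v') hbase) (F'.hV v' x) =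
      gV v' * F.hV v' x * (gV v')⁻¹)
  (hgE : ∀ (e' : 𝒢'.graph.Edge) (x : 𝒢'.Ge e'),
    𝒢.castGe (congrArg (fun k : 𝒢'.graph ⟶ 𝒢.graph => k.edgeMap e') hbase) (F'.hE e' x) =
      gE e' * F.hE e' x * (gE e')⁻¹)
  (hθ : ∀ (b' : 𝒢'.graph.Branch) (v' : 𝒢'.graph.Vertex) (h' : 𝒢'.graph.abuts b' = some v'),
    𝒢.castGv (congrArg (fun k : 𝒢'.graph ⟶ 𝒢.graph => k.vertexMap v') hbase) (θ'.θ b' v' h') =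
      gV v' * θ.θ b' v' h' *
        (𝒢.brHomAt (F.base.branchMap b') (F.base.vertexMap v') (F.base.abuts_branchMap b' v' h')
          (F.base.edgeMap (𝒢'.graph.edgeOf b')) (F.base.edgeOf_branchMap b')
          (gE (𝒢'.graph.edgeOf b')))⁻¹)

include hgV hgE hθ in
/-- ★ **Conjugate decorated morphisms over the same morphism of semi-graphs have isomorphic pull-back
functors** — for an arbitrary `F′` with `F′.base = F.base`, the conjugacy read through the transports
`castGv` / `castGe` (as in abc-iut-L3-t3's `Hom.IsoOver.of_conj`). [cite: MochizukiSemiAnbd2006, Prop 3.6(iv) p.39] -/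
theorem nonempty_covPullbackWith_iso_of_conj : Nonempty (F.covPullbackWith θ ≅ F'.covPullbackWith θ') := by
  obtain ⟨base', hV', hE', comm'⟩ := F'
  dsimp only at hbase θ' hgV hgE hθ ⊢
  subst hbase
  exact ⟨covPullbackWithConjIso F θ hV' hE' comm' gV gE (fun v' x => hgV v' x) (fun e' x => hgE e' x) θ'
    fun b' v' h' => hθ b' v' h'⟩

include hgV hgE hθ in
/-- The `B^temp` form for an arbitrary `F′` over `F.base`. [cite: MochizukiSemiAnbd2006, Prop 3.6(iv) p.39] -/
theorem nonempty_btempPullbackWith_iso_of_conj :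
    Nonempty (F.btempPullbackWith θ ≅ F'.btempPullbackWith θ') :=
  let ⟨e⟩ := nonempty_covPullbackWith_iso_of_conj hbase θ θ' gV gE hgV hgE hθ
  ⟨((ObjectProperty.fullyFaithfulι _).whiskeringRight _).preimageIso
    (Functor.isoWhiskerLeft (ObjectProperty.ι _) e)⟩

include hgV hgE hθ in
/-- The chart form for an arbitrary `F′` over `F.base`. [cite: MochizukiSemiAnbd2006, Prop 3.6(iv) p.39] -/
theorem nonempty_chartPullbackWith_iso_of_conj (c' : TemperedPiChart 𝒢') (c : TemperedPiChart 𝒢) :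
    Nonempty (F.chartPullbackWith θ c' c ≅ F'.chartPullbackWith θ' c' c) :=
  let ⟨e⟩ := nonempty_btempPullbackWith_iso_of_conj hbase θ θ' gV gE hgV hgE hθ
  ⟨Functor.isoWhiskerLeft c.equiv.inverse (Functor.isoWhiskerRight e c'.equiv.functor)⟩

end SameBase

/-! ### One morphism, two families of 2-cells: edge-uniform twists are invisible -/

section Twist

variable (F : Hom 𝒢' 𝒢) (θ θ' : F.ConjugatorFamily)
  (z : ∀ v' : 𝒢'.graph.Vertex, 𝒢.Gv (F.base.vertexMap v'))
  (k : ∀ e' : 𝒢'.graph.Edge, 𝒢.Ge (F.base.edgeMap e'))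
  (hz : ∀ (v' : 𝒢'.graph.Vertex) (x : 𝒢'.Gv v'), z v' * F.hV v' x = F.hV v' x * z v')
  (hk : ∀ (e' : 𝒢'.graph.Edge) (x : 𝒢'.Ge e'), k e' * F.hE e' x = F.hE e' x * k e')
  (hθ : ∀ (b' : 𝒢'.graph.Branch) (v' : 𝒢'.graph.Vertex) (h' : 𝒢'.graph.abuts b' = some v'),
    θ'.θ b' v' h' = z v' * θ.θ b' v' h' *
      (𝒢.brHomAt (F.base.branchMap b') (F.base.vertexMap v') (F.base.abuts_branchMap b' v' h')
        (F.base.edgeMap (𝒢'.graph.edgeOf b')) (F.base.edgeOf_branchMap b')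
        (k (𝒢'.graph.edgeOf b')))⁻¹)

/-- ★ **Two families of 2-cells of ONE morphism differing by an edge-uniform twist give isomorphic pull-back
functors**: `θ′_{b′} = z_{v′} · θ_{b′} · (F b′)_*(k_{e′})⁻¹` with `z_{v′}` centralising `F_{v′}(Π_{v′})` and
`k_{e′}` centralising `F_{e′}(Π_{e′})` (one element per EDGE, acting at both of its branches) ⟹ `F^*_θ ≅ F^*_{θ′}`
(the case `F′ = F` of `covPullbackWithConjIso`).  The Rmk 2.4.2 indeterminacy is a twist per BRANCH by the
centraliser of the image of the edge group; the RQ12 witness twists ONE branch of a loop.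
[cite: MochizukiSemiAnbd2006, Rmk 2.4.2 p.26] -/
def covPullbackWithTwistIso : F.covPullbackWith θ ≅ F.covPullbackWith θ' :=
  covPullbackWithConjIso F θ F.hV F.hE F.comm z k
    (fun v' x => eq_mul_inv_iff_mul_eq.mpr (hz v' x).symm)
    (fun e' x => eq_mul_inv_iff_mul_eq.mpr (hk e' x).symm) θ' hθ

/-- The `B^temp` form of the twist comparison. [cite: MochizukiSemiAnbd2006, Prop 3.6(iv) p.39] -/
def btempPullbackWithTwistIso : F.btempPullbackWith θ ≅ F.btempPullbackWith θ' :=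
  ((ObjectProperty.fullyFaithfulι _).whiskeringRight _).preimageIso
    (Functor.isoWhiskerLeft (ObjectProperty.ι _) (covPullbackWithTwistIso F θ θ' z k hz hk hθ))

/-- The chart form of the twist comparison. [cite: MochizukiSemiAnbd2006, Prop 3.6(iv) p.39] -/
def chartPullbackWithTwistIso (c' : TemperedPiChart 𝒢') (c : TemperedPiChart 𝒢) :
    F.chartPullbackWith θ c' c ≅ F.chartPullbackWith θ' c' c :=
  Functor.isoWhiskerLeft c.equiv.inverse
    (Functor.isoWhiskerRight (btempPullbackWithTwistIso F θ θ' z k hz hk hθ) c'.equiv.functor)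

end Twist

/-! ### Graph actions given up to conjugation: the pseudo-functoriality binders -/

section GraphAction

variable {PA : Type*} [Group PA] (A : PA → Hom 𝒢 𝒢) (θ : ∀ a, (A a).ConjugatorFamily)
  (c : TemperedPiChart 𝒢)

/-- **The binder `hmul` for actions given UP TO CONJUGATION.**  For `A : Π_A → Hom 𝒢 𝒢` with 2-cell data
`θ a` ([SemiAnbd] Def. 5.1 (i): "an action of `π̂₁(A)` on `𝔾`") such that `(A (a b), θ (a b))` lies over the
composite morphism of semi-graphs and is CONJUGATE to the composite `(A b ≫ A a, θ b ∘ θ a)` (abc-iut-L3-d2's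
`Hom.comp`, `ConjugatorFamily.comp`; `g_v`, `g_e` read through `castGv` / `castGe`):
`(A (a b))^*_{θ(ab)} ≅ (A a)^*_{θ a} ⋙ (A b)^*_{θ b}` through any chart — the shape of the binder `hmul` of
`ArithOuterActionOfGraphAction.exists_outerAction_of_graphAction`. [cite: MochizukiSemiAnbd2006, Def 5.1 (i), p. 62] -/
theorem nonempty_chartPullbackWith_mul_iso_of_conj (a b : PA)
    (hbase : (A (a * b)).base = ((A b).comp (A a)).base)
    (gV : ∀ v : 𝒢.graph.Vertex, 𝒢.Gv (((A b).comp (A a)).base.vertexMap v))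
    (gE : ∀ e : 𝒢.graph.Edge, 𝒢.Ge (((A b).comp (A a)).base.edgeMap e))
    (hgV : ∀ (v : 𝒢.graph.Vertex) (x : 𝒢.Gv v),
      𝒢.castGv (congrArg (fun k : 𝒢.graph ⟶ 𝒢.graph => k.vertexMap v) hbase) ((A (a * b)).hV v x) =
        gV v * ((A b).comp (A a)).hV v x * (gV v)⁻¹)
    (hgE : ∀ (e : 𝒢.graph.Edge) (x : 𝒢.Ge e),
      𝒢.castGe (congrArg (fun k : 𝒢.graph ⟶ 𝒢.graph => k.edgeMap e) hbase) ((A (a * b)).hE e x) =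
        gE e * ((A b).comp (A a)).hE e x * (gE e)⁻¹)
    (hθ : ∀ (b' : 𝒢.graph.Branch) (v : 𝒢.graph.Vertex) (h : 𝒢.graph.abuts b' = some v),
      𝒢.castGv (congrArg (fun k : 𝒢.graph ⟶ 𝒢.graph => k.vertexMap v) hbase) ((θ (a * b)).θ b' v h) =
        gV v * ((θ b).comp (θ a)).θ b' v h *
          (𝒢.brHomAt (((A b).comp (A a)).base.branchMap b') (((A b).comp (A a)).base.vertexMap v)
            (((A b).comp (A a)).base.abuts_branchMap b' v h)
            (((A b).comp (A a)).base.edgeMap (𝒢.graph.edgeOf b')) (((A b).comp (A a)).base.edgeOf_branchMap b')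
            (gE (𝒢.graph.edgeOf b')))⁻¹) :
    Nonempty ((A (a * b)).chartPullbackWith (θ (a * b)) c c ≅
      (A a).chartPullbackWith (θ a) c c ⋙ (A b).chartPullbackWith (θ b) c c) := by
  obtain ⟨e⟩ := nonempty_chartPullbackWith_iso_of_conj hbase ((θ b).comp (θ a)) _ gV gE hgV hgE hθ c c
  exact ⟨e.symm ≪≫ (A b).chartPullbackWithCompIso (A a) (θ b) (θ a) c c c⟩

/-- **The binder `hone` for actions given UP TO CONJUGATION**: if `(A 1, θ 1)` lies over the identity of
the semi-graph and is conjugate to `(id, 1)` (`Hom.identity`, `identityConjugators`), then `(A 1)^*_{θ 1} ≅ 𝟭`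
through any chart — the shape of the binder `hone` of `ArithOuterActionOfGraphAction.exists_outerAction_of_graphAction`.
[cite: MochizukiSemiAnbd2006, Def 5.1 (i), p. 62] -/
theorem nonempty_chartPullbackWith_one_iso_of_conj (hbase : (A 1).base = (Hom.identity 𝒢).base)
    (gV : ∀ v : 𝒢.graph.Vertex, 𝒢.Gv v) (gE : ∀ e : 𝒢.graph.Edge, 𝒢.Ge e)
    (hgV : ∀ (v : 𝒢.graph.Vertex) (x : 𝒢.Gv v),
      𝒢.castGv (congrArg (fun k : 𝒢.graph ⟶ 𝒢.graph => k.vertexMap v) hbase) ((A 1).hV v x) =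
        gV v * x * (gV v)⁻¹)
    (hgE : ∀ (e : 𝒢.graph.Edge) (x : 𝒢.Ge e),
      𝒢.castGe (congrArg (fun k : 𝒢.graph ⟶ 𝒢.graph => k.edgeMap e) hbase) ((A 1).hE e x) =
        gE e * x * (gE e)⁻¹)
    (hθ : ∀ (b : 𝒢.graph.Branch) (v : 𝒢.graph.Vertex) (h : 𝒢.graph.abuts b = some v),
      𝒢.castGv (congrArg (fun k : 𝒢.graph ⟶ 𝒢.graph => k.vertexMap v) hbase) ((θ 1).θ b v h) =
        gV v * (𝒢.brHom b v h (gE (𝒢.graph.edgeOf b)))⁻¹) :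
    Nonempty ((A 1).chartPullbackWith (θ 1) c c ≅ 𝟭 (BTemp c.G)) := by
  obtain ⟨e⟩ := nonempty_chartPullbackWith_iso_of_conj hbase (identityConjugators 𝒢) (θ 1) gV gE hgV hgE
    (fun b v h => by rw [hθ, identityConjugators_θ, mul_one]; rfl) c c
  exact ⟨e.symm ≪≫ chartPullbackWithIdentityIso 𝒢 c⟩

end GraphAction

end Hom

end ProfiniteSemiGraph

end Literature.AnabelianGeometry.SemiGraphs

end
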